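import Summits.ResolutionOfSingularities.ResolutionOfSingularities.Theorems.PurelyInseparableDim4SwapTransportWindowStep
import Summits.ResolutionOfSingularities.ResolutionOfSingularities.Theorems.PurelyInseparableDim4ResConeCInfPinningUTwoState
import Summits.ResolutionOfSingularities.ResolutionOfSingularities.Theorems.PurelyInseparableDim4UnitClassVertex
import HarnessLib
import HarnessLib.Audit.Tags

/-!
# Purely inseparable four-folds — ONE STEP OF THE VIRTUAL WINDOW, UNCONDITIONAL: the two foreign inputs of
# `virtual_step_slot` / `virtual_step_rotate` discharged by the tree (cell `res-dim4-pi`, K2(p) lane, slice B; K24b-R1)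

[OURS · counted 0 · cell `res-dim4-pi` · K24b-R1 (res-dim4-typ-1 g3).]  Nothing here proves K2(p)/K2(5), `NoIsolatedTrap 5 5`
or resolution of singularities in dimension ≥ 4 / characteristic `p` — NOT proved.  AI kernel work, weaker than expert review.

* `vtu_twoState` — the (VT-u) two-state hypothesis of `virtual_step_*`, BY NAME from res-dim4-p-2 g5's
  `ResCone.cInf_translation_u_eq_zero_twoState` (p-2's binders = the lead's `stub_VTu_twoState` verbatim).
* `eG_transfer` — the `e_G`-transfer hypothesis of `virtual_step_*`, BY NAME from res-dim4-p-7 g4's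
  `SwapNorm.finrank_resVertex_eq_of_slotUnit_rel₂` with the tangent `IsUnit` supplied by `isUnit_det_slotUnitClass₂`.
* **`virtual_step_slot'`**, **`virtual_step_rotate'`** — the two one-step transports of the virtual window with NO foreign
  hypothesis left: real slot step / real rotation ↦ pure virtual slot step, relation at precision `M − 5`, frame at jet
  `N − 4`, isolation and `e_G = 3` of the virtual child.
bears_on: LADDER-RESOLUTION:D157-DOOR2 (res-dim4-pi · K2(p) · slice B · K24b-R1).  Supports stmt-ResolutionOfSingularities-16155
(helper).
-/

set_option linter.dupNamespace false -- mandated namespace of this single-conjunct summit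

noncomputable section

namespace Summit.ResolutionOfSingularities.ResolutionOfSingularities.Theorems.PIDim4

namespace SwapTransport

open MvPolynomial Finset
open Literature.AlgebraicGeometry.Resolution
open Literature.AlgebraicGeometry.Resolution.CentreBlowup
open Literature.AlgebraicGeometry.Resolution.Hauser2010
open Literature.AlgebraicGeometry.Resolution.HauserPerlega2019

variable {K : Type} [Field K] [CharP K 5] [DecidableEq K]

/-! ## §1 The two foreign inputs, by name -/

/-- (VT-u) two-state in the shape consumed by `virtual_step_*` — res-dim4-p-2 g5's
`ResCone.cInf_translation_u_eq_zero_twoState` at jet `8`. [OURS · composition] -/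
theorem vtu_twoState {la mu u f : Fin 4} (hlm : la ≠ mu) (hlu : la ≠ u) (hlf : la ≠ f) (hmu : mu ≠ u) (hmf : mu ≠ f)
    (huf : u ≠ f) :
    ∀ (s : State K) (β : K), s.r = Finsupp.single la 1 + Finsupp.single mu 1 → ordZero s.F = 6 →
      (∀ e ∈ s.F.support, s.r ≤ e) → (∃ a : K, a ≠ 0 ∧ ResCone.resForm s = C a * X f ^ 4) →
      (∀ e ∈ s.F.support, e f ≤ 3 → 2 ≤ e la ∧ 2 ≤ e mu) →
      (∀ d ∈ s.F.support, d.degree < 8 → ¬ (d u = 2 ∧ d f = 0)) →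
      coeff (s.r + (Finsupp.single la 1 + Finsupp.single mu 1 + Finsupp.single u 3)) s.F ≠ 0 →
      ordZero (CentreBlowup.step 5 Finset.univ la (Pi.single u β) s).F = 6 →
      Module.finrank K (ResCone.resVertex (CentreBlowup.step 5 Finset.univ la (Pi.single u β) s)) = 3 → β = 0 := by
  intro s β hr ho hdiv hform hled hrow hV ho' he3'
  obtain ⟨a, ha, hform⟩ := hform
  exact ResCone.cInf_translation_u_eq_zero_twoState hlm hlu hlf hmu hmf huf (Or.inl rfl) hr ho hdiv ha hform hled le_rfl hrow
    hV ho' he3'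

omit [CharP K 5] [DecidableEq K] in
/-- `e_G` through the slot-unit class in the shape consumed by `virtual_step_*` — res-dim4-p-7 g4's
`SwapNorm.finrank_resVertex_eq_of_slotUnit_rel₂` (order `6`, prime to `5`), tangent `IsUnit` from the free `2 × 2` block by
`isUnit_det_slotUnitClass₂`. [OURS · composition] -/
theorem eG_transfer {la mu u f : Fin 4} (hlm : la ≠ mu) (hlu : la ≠ u) (hlf : la ≠ f) (hmu : mu ≠ u) (hmf : mu ≠ f)
    (huf : u ≠ f) :
    ∀ (π₁ : Equiv.Perm (Fin 4)) (A₁ B₁ : State K) (θ₁ e₁ : Fin 4 → MvPolynomial (Fin 4) K)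
      (U₁ E₁ : MvPolynomial (Fin 4) K) (M₁ : ℕ),
      θ₁ (π₁ la) = X la * e₁ la → θ₁ (π₁ mu) = X mu * e₁ mu → constantCoeff (e₁ la) ≠ 0 → constantCoeff (e₁ mu) ≠ 0 →
      constantCoeff (θ₁ (π₁ u)) = 0 → constantCoeff (θ₁ (π₁ f)) = 0 →
      coeff (Finsupp.single u 1) (θ₁ (π₁ u)) * coeff (Finsupp.single f 1) (θ₁ (π₁ f)) -
        coeff (Finsupp.single f 1) (θ₁ (π₁ u)) * coeff (Finsupp.single u 1) (θ₁ (π₁ f)) ≠ 0 →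
      constantCoeff U₁ ≠ 0 → E₁ ∈ originIdeal K ^ M₁ → B₁.F = deletePthPowers 5 (U₁ ^ 5 * aeval θ₁ A₁.F) + E₁ →
      A₁.r = Finsupp.single (π₁ la) 1 + Finsupp.single (π₁ mu) 1 → B₁.r = Finsupp.single la 1 + Finsupp.single mu 1 →
      (∀ d ∈ A₁.F.support, A₁.r ≤ d) → (∀ d ∈ B₁.F.support, B₁.r ≤ d) → ordZero A₁.F = 6 → ordZero B₁.F = 6 → 6 < M₁ →
      Module.finrank K (ResCone.resVertex B₁) = Module.finrank K (ResCone.resVertex A₁) := by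
  intro π₁ A₁ B₁ θ₁ e₁ U₁ E₁ M₁ h1 h2 h3 h4 h5 h6 h7 h8 h9 h10 h11 h12 h13 _ h15 _ h17
  exact SwapNorm.finrank_resVertex_eq_of_slotUnit_rel₂ 5 hlm hlu hlf hmu hmf huf h1 h2 h3 h4 h5 h6
    (isUnit_det_slotUnitClass₂ hlm hlu hlf hmu hmf huf h1 h2 h3 h4 h7) h8 h9 h10 h11 h12 h13 h15 (by norm_num) h17

/-! ## §2 The two window steps, unconditional -/

/-- **ONE STEP OF THE VIRTUAL WINDOW — SLOT CASE, unconditional** (`virtual_step_slot` with `vtu_twoState`, `eG_transfer`).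
[OURS] [cite: Hauser2010, §§F–G] [cite: CossartJannsenSaito2020, Thm. 3.14] -/
theorem virtual_step_slot' {π : Equiv.Perm (Fin 4)} {la mu u f : Fin 4} (hlm : la ≠ mu) (hlu : la ≠ u) (hlf : la ≠ f)
    (hmu : mu ≠ u) (hmf : mu ≠ f) (huf : u ≠ f)
    -- the relation at precision `M`
    {A B : State K} {θ e : Fin 4 → MvPolynomial (Fin 4) K} {U E : MvPolynomial (Fin 4) K} {M : ℕ}
    (hθa : θ (π la) = X la * e la) (hθa' : θ (π mu) = X mu * e mu) (hea : constantCoeff (e la) ≠ 0)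
    (hea' : constantCoeff (e mu) ≠ 0) (hu0 : constantCoeff (θ (π u)) = 0) (hf0 : constantCoeff (θ (π f)) = 0)
    (hdet : coeff (Finsupp.single u 1) (θ (π u)) * coeff (Finsupp.single f 1) (θ (π f)) -
      coeff (Finsupp.single f 1) (θ (π u)) * coeff (Finsupp.single u 1) (θ (π f)) ≠ 0)
    (hU : constantCoeff U ≠ 0) (hE : E ∈ originIdeal K ^ M) (hrel : B.F = deletePthPowers 5 (U ^ 5 * aeval θ A.F) + E)
    -- the real state and its honest slot step
    (hoA : ordZero A.F = 6) (hrA : A.r = Finsupp.single (π la) 1 + Finsupp.single (π mu) 1) {A' : State K}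
    {b : Fin 4 → K} (hbj : b (π la) = 0) (hstep : A' = CentreBlowup.step 5 Finset.univ (π la) b A)
    (hisoA' : IsIsolated 5 A'.F) {Nc : ℕ} (hcert : originIdeal K ^ Nc ≤ singLocusIdeal 5 A'.F ⊔ originIdeal K ^ (Nc + 1))
    (hoA' : ordZero A'.F = 6) (he3A' : Module.finrank K (ResCone.resVertex A') = 3) (hw1 : ∀ i, A'.r i ≤ 1)
    (hdegA' : A'.r.degree = 2) (hdivA' : ∀ d ∈ A'.F.support, A'.r ≤ d)
    -- the virtual frame at jet `N`
    (hoB : ordZero B.F = 6) (hrB : B.r = Finsupp.single la 1 + Finsupp.single mu 1) (hdivB : ∀ d ∈ B.F.support, B.r ≤ d)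
    {a : K} (ha : a ≠ 0) (hformB : ResCone.resForm B = C a * X f ^ 4)
    (hledB : ∀ e ∈ B.F.support, e f ≤ 3 → 2 ≤ e la ∧ 2 ≤ e mu) {N : ℕ} (hN : 12 ≤ N)
    (hrowB : ∀ d ∈ B.F.support, d.degree < N → ¬ (d u = 2 ∧ d f = 0))
    (hVB : coeff (B.r + (Finsupp.single la 1 + Finsupp.single mu 1 + Finsupp.single u 3)) B.F ≠ 0)
    (hM : Nc + 12 ≤ M) :
    b (π mu) = 0 ∧ A'.r = Finsupp.single (π la) 1 + Finsupp.single (π mu) 1 ∧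
    ∃ (θ' e' : Fin 4 → MvPolynomial (Fin 4) K) (U' E' : MvPolynomial (Fin 4) K),
      θ' (π la) = X la * e' la ∧ θ' (π mu) = X mu * e' mu ∧ constantCoeff (e' la) ≠ 0 ∧ constantCoeff (e' mu) ≠ 0 ∧
      constantCoeff (θ' (π u)) = 0 ∧ constantCoeff (θ' (π f)) = 0 ∧
      coeff (Finsupp.single u 1) (θ' (π u)) * coeff (Finsupp.single f 1) (θ' (π f)) -
        coeff (Finsupp.single f 1) (θ' (π u)) * coeff (Finsupp.single u 1) (θ' (π f)) ≠ 0 ∧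
      constantCoeff U' ≠ 0 ∧ E' ∈ originIdeal K ^ (M - 5) ∧
      (CentreBlowup.step 5 Finset.univ la 0 B).F = deletePthPowers 5 (U' ^ 5 * aeval θ' A'.F) + E' ∧
      -- the frame of the virtual child at jet `N − 4`
      ordZero (CentreBlowup.step 5 Finset.univ la 0 B).F = 6 ∧
      (CentreBlowup.step 5 Finset.univ la 0 B).r = Finsupp.single la 1 + Finsupp.single mu 1 ∧
      (∀ d ∈ (CentreBlowup.step 5 Finset.univ la 0 B).F.support, (CentreBlowup.step 5 Finset.univ la 0 B).r ≤ d) ∧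
      (∃ a' : K, a' ≠ 0 ∧ ResCone.resForm (CentreBlowup.step 5 Finset.univ la 0 B) = C a' * X f ^ 4) ∧
      (∀ e ∈ (CentreBlowup.step 5 Finset.univ la 0 B).F.support, e f ≤ 3 → 2 ≤ e la ∧ 2 ≤ e mu) ∧
      (∀ d ∈ (CentreBlowup.step 5 Finset.univ la 0 B).F.support, d.degree < N - 4 → ¬ (d u = 2 ∧ d f = 0)) ∧
      coeff ((CentreBlowup.step 5 Finset.univ la 0 B).r + (Finsupp.single la 1 + Finsupp.single mu 1 + Finsupp.single u 3))
        (CentreBlowup.step 5 Finset.univ la 0 B).F ≠ 0 ∧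
      IsIsolated 5 (CentreBlowup.step 5 Finset.univ la 0 B).F ∧
      Module.finrank K (ResCone.resVertex (CentreBlowup.step 5 Finset.univ la 0 B)) = 3 :=
  virtual_step_slot hlm hlu hlf hmu hmf huf hθa hθa' hea hea' hu0 hf0 hdet hU hE hrel hoA hrA hbj hstep hisoA' hcert hoA' he3A'
    hw1 hdegA' hdivA' hoB hrB hdivB ha hformB hledB hN hrowB hVB hM (vtu_twoState hlm hlu hlf hmu hmf huf)
    (fun A₁ B₁ θ₁ e₁ U₁ E₁ M₁ => eG_transfer hlm hlu hlf hmu hmf huf π A₁ B₁ θ₁ e₁ U₁ E₁ M₁)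

/-- **ONE STEP OF THE VIRTUAL WINDOW — ROTATION CASE, unconditional** (`virtual_step_rotate` with `vtu_twoState`,
`eG_transfer`). [OURS] [cite: Hauser2010, §§F–G] [cite: CossartJannsenSaito2020, Thm. 3.14] -/
theorem virtual_step_rotate' {π : Equiv.Perm (Fin 4)} {a a' u f g gt : Fin 4} (haa' : a ≠ a') (hau : a ≠ u) (haf : a ≠ f)
    (ha'u : a' ≠ u) (ha'f : a' ≠ f) (huf : u ≠ f) (hg : (g = u ∧ gt = f) ∨ (g = f ∧ gt = u))
    -- the relation at precision `M`
    {A B : State K} {θ e : Fin 4 → MvPolynomial (Fin 4) K} {U E : MvPolynomial (Fin 4) K} {M : ℕ}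
    (hθa : θ (π a) = X a * e a) (hθa' : θ (π a') = X a' * e a') (hea : constantCoeff (e a) ≠ 0)
    (hea' : constantCoeff (e a') ≠ 0) (hu0 : constantCoeff (θ (π u)) = 0) (hf0 : constantCoeff (θ (π f)) = 0)
    (hdet : coeff (Finsupp.single u 1) (θ (π u)) * coeff (Finsupp.single f 1) (θ (π f)) -
      coeff (Finsupp.single f 1) (θ (π u)) * coeff (Finsupp.single u 1) (θ (π f)) ≠ 0)
    (hU : constantCoeff U ≠ 0) (hE : E ∈ originIdeal K ^ M) (hrel : B.F = deletePthPowers 5 (U ^ 5 * aeval θ A.F) + E)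
    -- the real state and its honest rotation step
    (hoA : ordZero A.F = 6) {A' : State K} {b : Fin 4 → K} (hbj : b (π g) = 0) (hba : b (π a) ≠ 0) (hba' : b (π a') = 0)
    (hstep : A' = CentreBlowup.step 5 Finset.univ (π g) b A)
    (hisoA' : IsIsolated 5 A'.F) {Nc : ℕ} (hcert : originIdeal K ^ Nc ≤ singLocusIdeal 5 A'.F ⊔ originIdeal K ^ (Nc + 1))
    (hoA' : ordZero A'.F = 6) (he3A' : Module.finrank K (ResCone.resVertex A') = 3)
    (hrA' : A'.r = Finsupp.single (π g) 1 + Finsupp.single (π a') 1) (hdivA' : ∀ d ∈ A'.F.support, A'.r ≤ d)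
    -- the virtual frame at jet `N`
    (hoB : ordZero B.F = 6) (hrB : B.r = Finsupp.single a 1 + Finsupp.single a' 1) (hdivB : ∀ d ∈ B.F.support, B.r ≤ d)
    {aB : K} (haB : aB ≠ 0) (hformB : ResCone.resForm B = C aB * X f ^ 4)
    (hledB : ∀ e ∈ B.F.support, e f ≤ 3 → 2 ≤ e a ∧ 2 ≤ e a') {N : ℕ} (hN : 12 ≤ N)
    (hrowB : ∀ d ∈ B.F.support, d.degree < N → ¬ (d u = 2 ∧ d f = 0))
    (hVB : coeff (B.r + (Finsupp.single a 1 + Finsupp.single a' 1 + Finsupp.single u 3)) B.F ≠ 0)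
    (hM : Nc + 12 ≤ M) :
    ∃ (π' : Equiv.Perm (Fin 4)) (θ' e' : Fin 4 → MvPolynomial (Fin 4) K) (U' E' : MvPolynomial (Fin 4) K),
      π' = (Equiv.swap a g).trans π ∧ π' a = π g ∧ π' a' = π a' ∧ π' g = π a ∧ π' gt = π gt ∧
      θ' (π' a) = X a * e' a ∧ θ' (π' a') = X a' * e' a' ∧ constantCoeff (e' a) ≠ 0 ∧ constantCoeff (e' a') ≠ 0 ∧
      constantCoeff (θ' (π' u)) = 0 ∧ constantCoeff (θ' (π' f)) = 0 ∧
      coeff (Finsupp.single u 1) (θ' (π' u)) * coeff (Finsupp.single f 1) (θ' (π' f)) -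
        coeff (Finsupp.single f 1) (θ' (π' u)) * coeff (Finsupp.single u 1) (θ' (π' f)) ≠ 0 ∧
      constantCoeff U' ≠ 0 ∧ E' ∈ originIdeal K ^ (M - 5) ∧
      (CentreBlowup.step 5 Finset.univ a 0 B).F = deletePthPowers 5 (U' ^ 5 * aeval θ' A'.F) + E' ∧
      -- the frame of the virtual child at jet `N − 4`
      ordZero (CentreBlowup.step 5 Finset.univ a 0 B).F = 6 ∧
      (CentreBlowup.step 5 Finset.univ a 0 B).r = Finsupp.single a 1 + Finsupp.single a' 1 ∧
      (∀ d ∈ (CentreBlowup.step 5 Finset.univ a 0 B).F.support, (CentreBlowup.step 5 Finset.univ a 0 B).r ≤ d) ∧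
      (∃ c : K, c ≠ 0 ∧ ResCone.resForm (CentreBlowup.step 5 Finset.univ a 0 B) = C c * X f ^ 4) ∧
      (∀ e ∈ (CentreBlowup.step 5 Finset.univ a 0 B).F.support, e f ≤ 3 → 2 ≤ e a ∧ 2 ≤ e a') ∧
      (∀ d ∈ (CentreBlowup.step 5 Finset.univ a 0 B).F.support, d.degree < N - 4 → ¬ (d u = 2 ∧ d f = 0)) ∧
      coeff ((CentreBlowup.step 5 Finset.univ a 0 B).r + (Finsupp.single a 1 + Finsupp.single a' 1 + Finsupp.single u 3))
        (CentreBlowup.step 5 Finset.univ a 0 B).F ≠ 0 ∧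
      IsIsolated 5 (CentreBlowup.step 5 Finset.univ a 0 B).F ∧
      Module.finrank K (ResCone.resVertex (CentreBlowup.step 5 Finset.univ a 0 B)) = 3 :=
  virtual_step_rotate haa' hau haf ha'u ha'f huf hg hθa hθa' hea hea' hu0 hf0 hdet hU hE hrel hoA hbj hba hba' hstep hisoA'
    hcert hoA' he3A' hrA' hdivA' hoB hrB hdivB haB hformB hledB hN hrowB hVB hM (vtu_twoState haa' hau haf ha'u ha'f huf)
    (eG_transfer haa' hau haf ha'u ha'f huf)

end SwapTransport

end Summit.ResolutionOfSingularities.ResolutionOfSingularities.Theorems.PIDim4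

end
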